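import Mathlib.Algebra.MvPolynomial.Supported
import Mathlib.Algebra.Polynomial.Roots
import Mathlib.LinearAlgebra.Matrix.NonsingularInverse
import Mathlib.LinearAlgebra.Matrix.Polynomial
import HarnessLib

/-!
# Coefficient matrices of multilinear products and generic perturbations
(tools for Raz–Yehudayoff 2008, Lemma 4.3)

Support file for the proof of `Literature.Barriers.ValiantsHypothesis.RazYehudayoff2008_thm42`
(`FullRankMultilinearProofs.lean`). For a polynomial `g ∈ S[σ]` and two finite sets of
variables `U` (the "`Y`-variables") and `V` (the "`Z`-variables") the *coefficient matrix* (the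
"partial derivative matrix" of [RazYehudayoff2008, §4.2.2]) has rows the subsets `U' ⊆ U`,
columns the subsets `V' ⊆ V`, and entry the coefficient in `g` of the multilinear monomial
`∏_{k ∈ U' ∪ V'} x_k` (`cmat`). `FullRk g U V` says that its columns are linearly independent
(for `|U| = |V|`: the matrix has full rank `2^{|U|}`), phrased with plain test vectors
`v : Finset σ → S` so that no subtype bookkeeping enters the inductive proof. We prove the two
matrix facts used in the proof of [RazYehudayoff2008, Lemma 4.3]:

* `FullRk.mul` — for polynomials in disjoint sets of variables the coefficient matrix of the
  product is the Kronecker (tensor) product of the two coefficient matrices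
  (`coeff_ind_union_mul`, the source's eq. (4.2) "`M_{g₁ g₂} = M_{g₁} ⊗ M_{g₂}`"), so full rank is
  preserved;
* `FullRk.exists_add_C_mul` — over an infinite field, if `M_g` has full rank then so has
  `M_{h + γ g} = M_h + γ M_g` for some scalar `γ` (the determinant of `M_h + T · M_g` is a
  polynomial in `T` whose coefficient of `T^{2^{|U|}}` is `det M_g ≠ 0`,
  `exists_injective_mulVec_add_smul`); in the source this step is "the variable `ω_{i,ℓ,j}` does
  not occur in `f'`, so `Rank(M_{f_{i,j}}) ≥ Rank(M_{f_{i,ℓ} f_{ℓ+1,j}})`".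

Also the two base matrices: `fullRk_one` (`M_1 = (1)`) and `fullRk_one_add_X_mul_X`
(`M_{1 + y z}` is the `2 × 2` identity, "`Rank(M_{1 + A(x_i) A(x_j)}) = 2`").

## References
* [RazYehudayoff2008] R. Raz, A. Yehudayoff, *Balancing syntactically multilinear arithmetic
  circuits*, Comput. Complexity 17 (2008) 515–535, §4.2.2 and §4.3.1 (proof of Lemma 4.3).
-/

namespace Literature.Barriers.ValiantsHypothesis.RazYehudayoff

open MvPolynomial

variable {σ : Type*}

/-! ### Multilinear monomials indexed by finite sets -/

/-- The exponent vector of the monic multilinear monomial `∏_{k ∈ W} x_k`.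
[cite: RazYehudayoff2008, §4.2.2] -/
noncomputable def ind (W : Finset σ) : σ →₀ ℕ := ∑ k ∈ W, Finsupp.single k 1

/-- Pointwise description of `ind`. [folklore] -/
theorem ind_apply [DecidableEq σ] (W : Finset σ) (k : σ) :
    ind W k = if k ∈ W then 1 else 0 := by
  simp [ind, Finsupp.finsetSum_apply, Finsupp.single_apply]

/-- The empty monomial is `1`. [folklore] -/
@[simp] theorem ind_empty : ind (∅ : Finset σ) = 0 := by simp [ind]

/-- A single variable. [folklore] -/
theorem ind_singleton (a : σ) : ind ({a} : Finset σ) = Finsupp.single a 1 := by simp [ind]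

/-- Multilinear monomials multiply along disjoint unions. [folklore] -/
theorem ind_union [DecidableEq σ] {A B : Finset σ} (h : Disjoint A B) :
    ind (A ∪ B) = ind A + ind B := by
  unfold ind
  exact Finset.sum_union h

/-- The support of `ind W` is `W`. [folklore] -/
theorem support_ind (W : Finset σ) : (ind W).support = W := by
  classical
  ext k
  simp [Finsupp.mem_support_iff, ind_apply]

variable {S : Type*}

section Semiring

variable [CommSemiring S]

/-- A polynomial supported on the variables `W` only has monomials supported in `W`. [folklore] -/
theorem support_subset_of_mem_supported {g : MvPolynomial σ S} {W : Finset σ}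
    (hg : g ∈ supported S (↑W : Set σ)) {d : σ →₀ ℕ} (hd : coeff d g ≠ 0) : d.support ⊆ W := by
  intro k hk
  have hvars := mem_supported.1 hg
  have hk' : k ∈ g.vars := (mem_vars_iff_mem_support k).2 ⟨d, mem_support_iff.2 hd, hk⟩
  exact Finset.mem_coe.1 (hvars (Finset.mem_coe.2 hk'))

/-- **Coefficients of a product of polynomials in disjoint variables** (the entries of the
Kronecker product `M_{g₁} ⊗ M_{g₂}`): the coefficient of `∏_{A ∪ B} x_k` in `g₁ g₂` is the product
of the coefficient of `∏_A x_k` in `g₁` and of `∏_B x_k` in `g₂`, when `g₁` only involves the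
variables `W₁ ⊇ A`, `g₂` only `W₂ ⊇ B`, and `W₁ ∩ W₂ = ∅`. [cite: RazYehudayoff2008, §4.3.1 (eq. (4.2))] -/
theorem coeff_ind_union_mul [DecidableEq σ] {g₁ g₂ : MvPolynomial σ S} {W₁ W₂ A B : Finset σ}
    (hW : Disjoint W₁ W₂) (hg₁ : g₁ ∈ supported S (↑W₁ : Set σ))
    (hg₂ : g₂ ∈ supported S (↑W₂ : Set σ)) (hA : A ⊆ W₁) (hB : B ⊆ W₂) :
    coeff (ind (A ∪ B)) (g₁ * g₂) = coeff (ind A) g₁ * coeff (ind B) g₂ := by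
  have hAB : Disjoint A B := hW.mono hA hB
  rw [coeff_mul]
  apply Finset.sum_eq_single (ind A, ind B)
  · rintro ⟨e₁, e₂⟩ he hne
    rw [Finset.mem_antidiagonal] at he
    by_contra hprod
    have h₁ : coeff e₁ g₁ ≠ 0 := fun h => hprod (by simp [h])
    have h₂ : coeff e₂ g₂ ≠ 0 := fun h => hprod (by simp [h])
    have hs₁ := support_subset_of_mem_supported hg₁ h₁
    have hs₂ := support_subset_of_mem_supported hg₂ h₂
    have key : ∀ k, e₁ k + e₂ k = ind (A ∪ B) k := fun k => by
      have := DFunLike.congr_fun he k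
      simpa only [Finsupp.coe_add, Pi.add_apply] using this
    apply hne
    refine Prod.ext ?_ ?_
    · show e₁ = ind A
      ext k
      have hk := key k
      rw [ind_apply] at hk
      rw [ind_apply]
      by_cases hk₁ : k ∈ W₁
      · have hk₂ : k ∉ W₂ := Finset.disjoint_left.1 hW hk₁
        have he₂ : e₂ k = 0 := by
          by_contra h
          exact hk₂ (hs₂ (Finsupp.mem_support_iff.2 h))
        have hkB : k ∉ B := fun h => hk₂ (hB h)
        rw [he₂, add_zero] at hk
        rw [hk]
        simp [hkB]
      · have he₁ : e₁ k = 0 := by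
          by_contra h
          exact hk₁ (hs₁ (Finsupp.mem_support_iff.2 h))
        have hkA : k ∉ A := fun h => hk₁ (hA h)
        rw [he₁]
        simp [hkA]
    · show e₂ = ind B
      ext k
      have hk := key k
      rw [ind_apply] at hk
      rw [ind_apply]
      by_cases hk₂ : k ∈ W₂
      · have hk₁ : k ∉ W₁ := fun h => Finset.disjoint_left.1 hW h hk₂
        have he₁ : e₁ k = 0 := by
          by_contra h
          exact hk₁ (hs₁ (Finsupp.mem_support_iff.2 h))
        have hkA : k ∉ A := fun h => hk₁ (hA h)
        rw [he₁, zero_add] at hk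
        rw [hk]
        simp [hkA]
      · have he₂ : e₂ k = 0 := by
          by_contra h
          exact hk₂ (hs₂ (Finsupp.mem_support_iff.2 h))
        have hkB : k ∉ B := fun h => hk₂ (hB h)
        rw [he₂]
        simp [hkB]
  · intro h
    exact absurd (Finset.mem_antidiagonal.2 (ind_union hAB).symm) h

/-! ### Full rank of the coefficient matrix -/

/-- **Full rank of the partial derivative matrix, column form.** For `g ∈ S[σ]` and finite sets
of variables `U` ("`Y`") and `V` ("`Z`"): every test vector `v` on the subsets of `V` that is
annihilated by all rows `U' ⊆ U` of the coefficient matrix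
`(U', V') ↦ coeff (∏_{U' ∪ V'} x_k) g` vanishes on the subsets of `V`, i.e. the `2^{|V|}` columns
of `M_g` are linearly independent (`fullRk_iff_injective`); for `|U| = |V|` this is
"`Rank(M_g) = 2^{|U|}`". [cite: RazYehudayoff2008, §4.2.2 and Lemma 4.3] -/
def FullRk [DecidableEq σ] (g : MvPolynomial σ S) (U V : Finset σ) : Prop :=
  ∀ v : Finset σ → S,
    (∀ U', U' ⊆ U → ∑ V' ∈ V.powerset, coeff (ind (U' ∪ V')) g * v V' = 0) →
      ∀ V', V' ⊆ V → v V' = 0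

/-- Summing over the subsets of a disjoint union `V₁ ⊔ V₂` = summing over pairs of subsets.
[folklore] -/
theorem sum_powerset_union [DecidableEq σ] {M : Type*} [AddCommMonoid M] {V₁ V₂ : Finset σ}
    (h : Disjoint V₁ V₂) (F : Finset σ → M) :
    ∑ V' ∈ (V₁ ∪ V₂).powerset, F V' =
      ∑ V₁' ∈ V₁.powerset, ∑ V₂' ∈ V₂.powerset, F (V₁' ∪ V₂') := by
  rw [← Finset.sum_product']
  symm
  refine Finset.sum_nbij' (fun p => p.1 ∪ p.2) (fun V' => (V' ∩ V₁, V' ∩ V₂)) ?_ ?_ ?_ ?_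
    (fun _ _ => rfl)
  · rintro ⟨V₁', V₂'⟩ hp
    simp only [Finset.mem_product, Finset.mem_powerset] at hp
    exact Finset.mem_powerset.2 (Finset.union_subset_union hp.1 hp.2)
  · intro V' hV'
    simp only [Finset.mem_powerset] at hV'
    simp only [Finset.mem_product, Finset.mem_powerset]
    exact ⟨Finset.inter_subset_right, Finset.inter_subset_right⟩
  · rintro ⟨V₁', V₂'⟩ hp
    simp only [Finset.mem_product, Finset.mem_powerset] at hp
    have h1 : ∀ k ∈ V₂', k ∉ V₁ := fun k hk hk1 => Finset.disjoint_left.1 h hk1 (hp.2 hk)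
    have h2 : ∀ k ∈ V₁', k ∉ V₂ := fun k hk hk2 => Finset.disjoint_left.1 h (hp.1 hk) hk2
    refine Prod.ext ?_ ?_
    · show (V₁' ∪ V₂') ∩ V₁ = V₁'
      ext k
      simp only [Finset.mem_inter, Finset.mem_union]
      constructor
      · rintro ⟨hk | hk, hk1⟩
        · exact hk
        · exact absurd hk1 (h1 k hk)
      · intro hk
        exact ⟨Or.inl hk, hp.1 hk⟩
    · show (V₁' ∪ V₂') ∩ V₂ = V₂'
      ext k
      simp only [Finset.mem_inter, Finset.mem_union]
      constructor
      · rintro ⟨hk | hk, hk2⟩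
        · exact absurd hk2 (h2 k hk)
        · exact hk
      · intro hk
        exact ⟨Or.inr hk, hp.2 hk⟩
  · intro V' hV'
    rw [Finset.mem_powerset] at hV'
    show (V' ∩ V₁) ∪ (V' ∩ V₂) = V'
    rw [← Finset.inter_union_distrib_left]
    exact Finset.inter_eq_left.2 hV'

/-- **Full rank is preserved under products of polynomials in disjoint variables**
("`Rank(M_{g₁} ⊗ M_{g₂}) = Rank(M_{g₁}) · Rank(M_{g₂})`"). [cite: RazYehudayoff2008, §4.3.1 (eq. (4.2))] -/
theorem FullRk.mul [DecidableEq σ] {g₁ g₂ : MvPolynomial σ S} {W₁ W₂ U₁ V₁ U₂ V₂ : Finset σ}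
    (hW : Disjoint W₁ W₂) (hg₁ : g₁ ∈ supported S (↑W₁ : Set σ))
    (hg₂ : g₂ ∈ supported S (↑W₂ : Set σ)) (hU₁ : U₁ ⊆ W₁) (hV₁ : V₁ ⊆ W₁) (hU₂ : U₂ ⊆ W₂)
    (hV₂ : V₂ ⊆ W₂) (h₁ : FullRk g₁ U₁ V₁) (h₂ : FullRk g₂ U₂ V₂) :
    FullRk (g₁ * g₂) (U₁ ∪ U₂) (V₁ ∪ V₂) := by
  intro v hv V' hV'
  have hV : Disjoint V₁ V₂ := hW.mono hV₁ hV₂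
  have step1 : ∀ U₂', U₂' ⊆ U₂ → ∀ V₁', V₁' ⊆ V₁ →
      ∑ V₂' ∈ V₂.powerset, coeff (ind (U₂' ∪ V₂')) g₂ * v (V₁' ∪ V₂') = 0 := by
    intro U₂' hU₂'
    refine h₁ (fun V₁' => ∑ V₂' ∈ V₂.powerset, coeff (ind (U₂' ∪ V₂')) g₂ * v (V₁' ∪ V₂')) ?_
    intro U₁' hU₁'
    have := hv (U₁' ∪ U₂') (Finset.union_subset_union hU₁' hU₂')
    rw [sum_powerset_union hV] at this
    rw [← this]
    refine Finset.sum_congr rfl fun V₁' hV₁' => ?_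
    rw [Finset.mul_sum]
    refine Finset.sum_congr rfl fun V₂' hV₂' => ?_
    rw [Finset.mem_powerset] at hV₁' hV₂'
    rw [Finset.union_union_union_comm U₁' U₂' V₁' V₂',
      coeff_ind_union_mul hW hg₁ hg₂ (Finset.union_subset (hU₁'.trans hU₁) (hV₁'.trans hV₁))
        (Finset.union_subset (hU₂'.trans hU₂) (hV₂'.trans hV₂))]
    ring
  have step2 : ∀ V₁', V₁' ⊆ V₁ → ∀ V₂', V₂' ⊆ V₂ → v (V₁' ∪ V₂') = 0 := by
    intro V₁' hV₁'
    exact h₂ (fun V₂' => v (V₁' ∪ V₂')) (fun U₂' hU₂' => step1 U₂' hU₂' V₁' hV₁')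
  have hsplit : V' = (V' ∩ V₁) ∪ (V' ∩ V₂) := by
    rw [← Finset.inter_union_distrib_left]
    exact (Finset.inter_eq_left.2 hV').symm
  rw [hsplit]
  exact step2 _ Finset.inter_subset_right _ Finset.inter_subset_right

/-- Base case `m = 0` of [RazYehudayoff2008, Lemma 4.3]: `M_1 = (1)` has rank `1 = 2^0`.
[cite: RazYehudayoff2008, §4.3.1 (induction base)] -/
theorem fullRk_one [DecidableEq σ] : FullRk (1 : MvPolynomial σ S) ∅ ∅ := by
  intro v hv V' hV'
  have hV'0 : V' = ∅ := Finset.subset_empty.1 hV'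
  have := hv ∅ (Finset.Subset.refl _)
  simp only [Finset.powerset_empty, Finset.sum_singleton, Finset.empty_union, ind_empty,
    coeff_zero_one, one_mul] at this
  rw [hV'0]
  exact this

/-- "`Rank(M_{1 + A(x_i) A(x_j)}) = 2`": for `y ≠ z` the coefficient matrix of `1 + y z` with
respect to `({y}, {z})` is the `2 × 2` identity. [cite: RazYehudayoff2008, §4.3.1 (Case one)] -/
theorem fullRk_one_add_X_mul_X [DecidableEq σ] {a b : σ} (hab : a ≠ b) :
    FullRk (1 + X a * X b : MvPolynomial σ S) {a} {b} := by
  intro v hv V' hV'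
  have hXX : (X a * X b : MvPolynomial σ S) =
      monomial (Finsupp.single a 1 + Finsupp.single b 1) 1 := by
    rw [X, X, monomial_mul, one_mul]
  have hpow : ({b} : Finset σ).powerset = {∅, {b}} := by
    ext s
    simp [Finset.subset_singleton_iff]
  have hne : (∅ : Finset σ) ≠ {b} := (Finset.singleton_ne_empty b).symm
  have hs0 : (Finsupp.single a 1 + Finsupp.single b 1 : σ →₀ ℕ) ≠ 0 := by
    intro h
    have := DFunLike.congr_fun h a
    simp [hab] at this
  have hsb : (Finsupp.single a 1 + Finsupp.single b 1 : σ →₀ ℕ) ≠ Finsupp.single b 1 := by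
    intro h
    have := DFunLike.congr_fun h a
    simp [Ne.symm hab] at this
  have hsa : (Finsupp.single a 1 + Finsupp.single b 1 : σ →₀ ℕ) ≠ Finsupp.single a 1 := by
    intro h
    have := DFunLike.congr_fun h b
    simp [hab] at this
  have h0b : (0 : σ →₀ ℕ) ≠ Finsupp.single b 1 := by
    intro h
    have := DFunLike.congr_fun h b
    simp at this
  have h0a : (0 : σ →₀ ℕ) ≠ Finsupp.single a 1 := by
    intro h
    have := DFunLike.congr_fun h a
    simp at this
  have c00 : coeff (ind ((∅ : Finset σ) ∪ ∅)) (1 + X a * X b : MvPolynomial σ S) = 1 := by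
    rw [hXX, Finset.empty_union, ind_empty, coeff_add, coeff_zero_one, coeff_monomial,
      if_neg hs0, add_zero]
  have c0b : coeff (ind ((∅ : Finset σ) ∪ {b})) (1 + X a * X b : MvPolynomial σ S) = 0 := by
    rw [hXX, Finset.empty_union, ind_singleton, coeff_add, coeff_one, if_neg h0b, coeff_monomial,
      if_neg hsb, add_zero]
  have ca0 : coeff (ind (({a} : Finset σ) ∪ ∅)) (1 + X a * X b : MvPolynomial σ S) = 0 := by
    rw [hXX, Finset.union_empty, ind_singleton, coeff_add, coeff_one, if_neg h0a, coeff_monomial,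
      if_neg hsa, add_zero]
  have cab : coeff (ind (({a} : Finset σ) ∪ {b})) (1 + X a * X b : MvPolynomial σ S) = 1 := by
    rw [hXX, ind_union (Finset.disjoint_singleton.2 hab), ind_singleton, ind_singleton, coeff_add,
      coeff_one, if_neg hs0.symm, coeff_monomial, if_pos rfl, zero_add]
  have e0 := hv ∅ (Finset.empty_subset _)
  have ea := hv {a} (Finset.Subset.refl _)
  rw [hpow, Finset.sum_pair hne] at e0 ea
  rw [c00, c0b] at e0
  rw [ca0, cab] at ea
  simp only [one_mul, zero_mul, add_zero, zero_add] at e0 ea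
  rcases Finset.subset_singleton_iff.1 hV' with h | h <;> rw [h]
  · exact e0
  · exact ea

/-! ### Matrix form and generic perturbations -/

/-- The coefficient ("partial derivative") matrix of `g` with respect to `(U, V)`: rows the
subsets of `U`, columns the subsets of `V`, entry the coefficient of `∏_{U' ∪ V'} x_k`.
[cite: RazYehudayoff2008, §4.2.2] -/
noncomputable def cmat [DecidableEq σ] (g : MvPolynomial σ S) (U V : Finset σ) :
    Matrix U.powerset V.powerset S :=
  Matrix.of fun a b => coeff (ind (a.1 ∪ b.1)) g

/-- Entries of `cmat`. [folklore] -/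
@[simp] theorem cmat_apply [DecidableEq σ] (g : MvPolynomial σ S) (U V : Finset σ)
    (a : U.powerset) (b : V.powerset) : cmat g U V a b = coeff (ind (a.1 ∪ b.1)) g := rfl

end Semiring

section Ring

variable [CommRing S]

/-- `FullRk g U V` is injectivity of `M_g` on column vectors (linear independence of the
`2^{|V|}` columns). [folklore] -/
theorem fullRk_iff_injective [DecidableEq σ] (g : MvPolynomial σ S) (U V : Finset σ) :
    FullRk g U V ↔ Function.Injective (cmat g U V).mulVec := by
  constructor
  · intro h v w hvw
    rw [← sub_eq_zero]
    have hd0 : (cmat g U V).mulVec (v - w) = 0 := by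
      rw [Matrix.mulVec_sub, hvw, sub_self]
    let w' : Finset σ → S := fun V' => if hV : V' ∈ V.powerset then (v - w) ⟨V', hV⟩ else 0
    have hw' : ∀ V', V' ⊆ V → w' V' = 0 := by
      refine h w' fun U' hU' => ?_
      have happ := congr_fun hd0 ⟨U', Finset.mem_powerset.2 hU'⟩
      rw [Pi.zero_apply] at happ
      rw [← happ]
      simp only [Matrix.mulVec, dotProduct, cmat_apply]
      rw [← Finset.sum_coe_sort V.powerset]
      refine Finset.sum_congr rfl fun b _ => ?_
      simp only [w', dif_pos b.2]
    funext b
    have := hw' b.1 (Finset.mem_powerset.1 b.2)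
    simp only [w', dif_pos b.2] at this
    exact this
  · intro hinj v hv V' hV'
    let d : V.powerset → S := fun b => v b.1
    have hd : (cmat g U V).mulVec d = 0 := by
      funext a
      simp only [Matrix.mulVec, dotProduct, cmat_apply, Pi.zero_apply]
      rw [← hv a.1 (Finset.mem_powerset.1 a.2), ← Finset.sum_coe_sort V.powerset]
    have hd0 : d = 0 := hinj (by rw [hd, Matrix.mulVec_zero])
    exact congr_fun hd0 ⟨V', Finset.mem_powerset.2 hV'⟩

end Ring

section Field

variable [Field S]

/-- **Generic perturbation keeps full rank.** Over an infinite field, if `P` (square up to a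
relabelling of the columns) is injective then `N + γ P` is injective for some scalar `γ`:
`det (N + T P)` is a polynomial in `T` with coefficient `det P ≠ 0` at `T^{card}`, hence has a
non-root. [folklore] -/
theorem exists_injective_mulVec_add_smul [Infinite S] {ι κ : Type*} [Fintype ι] [Fintype κ]
    [DecidableEq ι] [DecidableEq κ] (hcard : Fintype.card ι = Fintype.card κ)
    (N P : Matrix ι κ S) (hP : Function.Injective P.mulVec) :
    ∃ γ : S, Function.Injective (N + γ • P).mulVec := by
  obtain ⟨e⟩ : Nonempty (ι ≃ κ) := Fintype.card_eq.1 hcard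
  have key : ∀ Q : Matrix ι κ S,
      Function.Injective (Q.submatrix id e).mulVec ↔ Function.Injective Q.mulVec := by
    intro Q
    have hQ : (Q.submatrix id e).mulVec = Q.mulVec ∘ (Equiv.arrowCongr e (Equiv.refl S)) := by
      funext v
      rw [Matrix.submatrix_mulVec_equiv]
      rfl
    rw [hQ]
    exact Function.Injective.of_comp_iff' _ (Equiv.bijective _)
  have hP' : IsUnit (P.submatrix id e) :=
    Matrix.mulVec_injective_iff_isUnit.1 ((key P).2 hP)
  have hdetP : (P.submatrix id e).det ≠ 0 := by
    rw [Matrix.isUnit_iff_isUnit_det, isUnit_iff_ne_zero] at hP'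
    exact hP'
  set p : Polynomial S := ((Polynomial.X : Polynomial S) • (P.submatrix id e).map Polynomial.C +
    (N.submatrix id e).map Polynomial.C).det with hp
  have hp0 : p ≠ 0 := by
    intro h
    have := Polynomial.coeff_det_X_add_C_card (P.submatrix id e) (N.submatrix id e)
    rw [← hp, h, Polynomial.coeff_zero] at this
    exact hdetP this.symm
  obtain ⟨γ, hγ⟩ : ∃ γ : S, ¬ p.IsRoot γ := by
    by_contra hall
    push Not at hall
    apply hp0
    apply Polynomial.eq_zero_of_infinite_isRoot
    exact Set.infinite_univ.mono fun x _ => hall x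
  refine ⟨γ, (key _).1 ?_⟩
  have heval : p.eval γ = (N.submatrix id e + γ • P.submatrix id e).det := by
    rw [hp, ← Polynomial.coe_evalRingHom, RingHom.map_det, RingHom.mapMatrix_apply]
    congr 1
    ext a b
    simp only [Matrix.map_apply, Matrix.add_apply, Matrix.smul_apply, smul_eq_mul,
      Polynomial.coe_evalRingHom, Polynomial.eval_add, Polynomial.eval_mul, Polynomial.eval_X,
      Polynomial.eval_C]
    ring
  have hsub : (N + γ • P).submatrix id e = N.submatrix id e + γ • P.submatrix id e := rfl
  rw [hsub]
  apply Matrix.mulVec_injective_iff_isUnit.2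
  rw [Matrix.isUnit_iff_isUnit_det, isUnit_iff_ne_zero, ← heval]
  exact hγ

/-- **Case two of [RazYehudayoff2008, Lemma 4.3], abstract form.** Over an infinite field: if
`M_g` has full rank with respect to `(U, V)`, `|U| = |V|`, then for some scalar `γ` so has
`M_{h + γ g} = M_h + γ M_g`. [cite: RazYehudayoff2008, §4.3.1 (Case two)] -/
theorem FullRk.exists_add_C_mul [Infinite S] [DecidableEq σ] {g : MvPolynomial σ S}
    {U V : Finset σ} (hUV : U.card = V.card) (hg : FullRk g U V) (h : MvPolynomial σ S) :
    ∃ γ : S, FullRk (h + C γ * g) U V := by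
  have hcard : Fintype.card U.powerset = Fintype.card V.powerset := by
    simp [Fintype.card_coe, Finset.card_powerset, hUV]
  obtain ⟨γ, hγ⟩ := exists_injective_mulVec_add_smul hcard (cmat h U V) (cmat g U V)
    ((fullRk_iff_injective g U V).1 hg)
  refine ⟨γ, (fullRk_iff_injective _ U V).2 ?_⟩
  have hm : cmat (h + C γ * g) U V = cmat h U V + γ • cmat g U V := by
    ext a b
    simp [coeff_C_mul]
  rw [hm]
  exact hγ

end Field

end Literature.Barriers.ValiantsHypothesis.RazYehudayoff
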